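import Summits.QuantumFields.BalabanUV.T4Continuum.Support.ShellMeasureWilsonGaugeInvariant
import Literature.MathematicalPhysics.QuantumFieldTheory.Balaban1983to89.T4ShellMeasureLocal

/-!
# `T4Continuum.ShellMeasureWilsonStraddle` — (MR)₀: the OTHER cubes' small-field CO-TESTS in the realized level-0
# slot measure — interior parts KEPT for free, straddling parts DROPPED under a DISPLAYED mass ratio
# (cell `pub-balaban`, sub-cell `t4`, spine estimate NE7c (node U5b); ROUND-2 crew `t4-ne7c-formalise-*`, leaf prover 03,
# row S2 of the crew claim table `t4/b2b-balaban-t4-ne7c-p1/LEAVES-NE7c-P1.md` under `t4/T4-NE7c-TRIGGER.json`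
# (conditions c1–c6); ADDITIVE — imports row S1's `ShellMeasureWilsonGaugeInvariant` (p207446) and the tree's
# `T4ShellMeasureLocal` (p192531, the union-bound mass ratio) only; 0 `def`, 0 sorry; consumed by road P1's level-0
# face of END-I `ShellMeasureRootComposition.shellWeightBound_of_slotAC` (binder `hac` at level 0), trigger c6)

HONEST FRAMING.  Finite four-torus programme, rung (B)+1 only — NOT infinite volume, NOT a mass gap, NOT the Clay
problem, NOT summit progress; (B), `BetaPertHyp`, (B^μ) not consumed.  NE7c = `T4IndicatorShell.ShellWeightBound` is
NOT PRINTED in [Balaban 1983–89] and NOT PROVED; «NE7c ⇐ the named binders» (trigger c3); (M1)₀ realized ≠ NE7c.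
(M1) for BAŁABAN'S INDUCTIVELY DEFINED EFFECTIVE MEASURES is NOT PRINTED (GAPS G-ne7cp1-1) and asserted by nobody.
THIS FILE is level-0 BOOKKEEPING plus ONE DISPLAYED BINDER: the realized slot measure of a level-0 slot carries, besides
the Wilson weight, the small-field tests `1[dist1 U(∂p) < σ, p ∈ Q_i]` of the OTHER cubes `i ∈ I` (B14 (2.17) at
`k = 0`; the slot's own test removed — reading (R)).  Relative to the slot's box `[lo, hi]` a co-test splits as a KERNEL
IDENTITY `1[Q_i σ-small] = 1[Q_i ∩ box σ-small] · 1[Q_i \ box σ-small]` (§2): the interior factor is IMPLIED on the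
threshold shell by row S1's box co-test and rides free (§1 `slotAntiConcentration_withDensity_of_le_on_shell`, mass ratio
`1`); the remainder (plaquettes STRADDLING the box, and — if the consumer does not factor them into a block-blind exterior
weight — exterior ones), together with any further dropped event `E`, is DROPPED by domination
(`T4ShellMeasureFibre.slotAntiConcentration_of_dominated`): shell monotone because the density only decreases, total mass
paid by the MASS RATIO `M` — «`μ_box(everything) ≤ M · μ_box(all dropped co-tests pass)`» for the box-windowed law
`μ_box` of row S1 — which is an ESTIMATE (small-field dominance of the Wilson measure, B15 p. 193 / B16 (1.89) KIND),
DISPLAYED AS A BINDER `hM`, NOT a `def … : Prop`, NOT proved here (trigger c2); under the union-bound data «each of the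
`#I` dropped tests fails with relative `μ_box`-mass `≤ q`, `#I·q ≤ 1/2`» it is `M = 2` by the tree's
`T4ShellMeasureLocal.measure_univ_le_two_mul_of_unionBound` (BY NAME).  0 sorry, 0 citations; the series enters only
through the DEFINITIONS `Setup.PlaqSmallOn`, `chiSmall`, `plaqHol`, `reTr`, `dist1` (B14 (1.1), B12 (0.2), B7 (19)).
HONEST DEPENDENCY (cell): continuum YM on T⁴ ⇐ BetaPertH ∧ nine spine estimates (0/9 proved); BetaPertH ⇐ (D1) ∧ (D4) ∧
CAP+tail; G-an2-4 gates asym, D1 and NE2/3/4.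

WHAT IS PROVED (all [folklore]).  §1 (any measure space): `slotAntiConcentration_withDensity_drop` — (M1) for
`F dν` with constant `D` + mass ratio `(F dν)(univ) ≤ M·(F dν)(E)` ⟹ (M1) for `(F·1_E) dν` with `D·M`; `…_drop_two`
(`M = 2`, union bound); `slotAntiConcentration_withDensity_of_le_on_shell` — `F′ ≤ F` with `F = F′` on the shell
`{θ(1−ρ) ≤ u < θ}` ⟹ `F dν` inherits (M1) from `F′ dν`, SAME constant.  §2 (any gauge group): the split identities
`setOf_plaqSmallOn_split` / `chiSmall_split` / `biInter_setOf_plaqSmallOn_split`, monotonicity, the cover lemma,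
`wilsonU_lt_iff`.  §3 (`G = SU(2)`): `slotAntiConcentration_coTests_of_boxTest` — for ANY measurable weight `W`,
(M1)₀ for the box-windowed law `(1[box σ-small]·W) dU` (row S1's shape, constant `D`) + `θ ≤ σ` + the cover «every
box plaquette outside `P_u` is tested by some co-test» + the mass ratio `M` of `(⋂_i 1[Q_i \ box σ-small]) ∩ E`
under that law ⟹ (M1)₀ for the CO-TESTED law `(1[⋂_i Q_i σ-small ∩ E]·W) dU` — NO box window left — constant `D·M`;
`slotAntiConcentration_wilson_su2_coTests(_two)` — `W` = Wilson weight of B12 (0.2) over `P_w`, `D` = row S1's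
`2(n + β·#P_w·8S(8+32S))/(1−δ)` BY NAME (resp. `M = 2` from the union-bound data).

WHAT THIS DOES NOT DO.  The mass ratio `M` (resp. the per-test failure fraction `q`) is NOT proved — it is the (MR)₀
estimate, displayed; exterior-only co-tests and the exterior Wilson factor are better carried as a block-blind
gauge-invariant factor of `W` (row S1's theorem is the case `W` = Wilson weight over `P_w`; a blind-factor version of
it is a separate file) than dropped; large-field complements `1 − χ` meeting the box are covered only as part of the
dropped event `E` (their mass ratio is NOT small-field dominated); anything at `j ≥ 1`; NE7c NOT proved; 0/9 spine.
-/

noncomputable section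

open Set Function MeasureTheory

namespace Summit.QuantumFields.BalabanUV.T4Continuum.ShellMeasureWilsonStraddle

open scoped ENNReal
open Literature.MathematicalPhysics.QuantumFieldTheory.Balaban1983to89
open T4ShellMeasure (SlotAntiConcentration)
open T4ShellMeasureFibre (slotAntiConcentration_of_dominated)
open T4ShellMeasureLocal (measure_univ_le_two_mul_of_unionBound)
open T4CubeChartGnomonic (SU2)
open T4AxialGaugeFixing (combBonds measurableSet_plaqSmallOn)
open T4AxialGaugeSmallField (boxPlaqs boxBonds)
open ShellMeasureWilsonRealizedSU2 (wilsonU measurable_wilsonSum)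
open ShellMeasureWilsonGaugeInvariant (boxTest giF measurableSet_boxTest giF_le_one slotAntiConcentration_wilson_su2_gaugeInvariant)

/-! ## §1 (M1) under dropped and under shell-neutral density factors (abstract) -/

section Abstract

/-- the density `F · 1_E` is the restriction `1_E · F` of `F` to `E`. [folklore] -/
theorem mul_indicator_one_eq_indicator {Ω : Type*} (F : Ω → ℝ≥0∞) (E : Set Ω) :
    (fun x => F x * E.indicator 1 x) = E.indicator F := by
  funext x; by_cases hx : x ∈ E
  · rw [indicator_of_mem hx, indicator_of_mem hx, Pi.one_apply, mul_one]
  · rw [indicator_of_notMem hx, indicator_of_notMem hx, mul_zero]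

/-- a dropped test only lowers the density: `F·1_E ≤ F`. [folklore] -/
theorem mul_indicator_one_le {Ω : Type*} (F : Ω → ℝ≥0∞) (E : Set Ω) (x : Ω) :
    F x * E.indicator 1 x ≤ F x := by
  have h1 : E.indicator (1 : Ω → ℝ≥0∞) x ≤ 1 := indicator_apply_le' (fun _ => le_rfl) (fun _ => zero_le_one)
  calc F x * E.indicator 1 x ≤ F x * 1 := mul_le_mul' le_rfl h1
    _ = F x := mul_one _

variable {Ω : Type*} [MeasurableSpace Ω] (ν : Measure Ω)

/-- TOTAL MASS OF A DROPPED-TEST DENSITY: `(F·1_E) dν (everything) = F dν (E)`. [folklore] -/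
theorem withDensity_mul_indicator_univ (F : Ω → ℝ≥0∞) {E : Set Ω} (hE : MeasurableSet E) :
    ν.withDensity (fun x => F x * E.indicator 1 x) univ = ν.withDensity F E := by
  rw [mul_indicator_one_eq_indicator, withDensity_indicator hE, withDensity_apply _ MeasurableSet.univ,
    Measure.restrict_univ, withDensity_apply _ hE]

/-- **(M1) WITH A DROPPED CO-TEST (domination, the (MR) mechanism).**  If `F dν` satisfies
`SlotAntiConcentration … u θ ρ D` and the MASS RATIO of the measurable event `E` under `F dν` is `M`
(`(F dν)(everything) ≤ M·(F dν)(E)` — the DISPLAYED estimate binder), then the dropped-test law `(F·1_E) dν` satisfies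
(M1) for the same `u, θ, ρ` with constant `D·M`: the threshold shell only loses mass (`F·1_E ≤ F`), the total mass is
paid by `M` (`T4ShellMeasureFibre.slotAntiConcentration_of_dominated`). [folklore] -/
theorem slotAntiConcentration_withDensity_drop {F : Ω → ℝ≥0∞} {u : Ω → ℝ} {θ ρ D M : ℝ} (hD : 0 ≤ D)
    (hρ : 0 ≤ ρ) (h : SlotAntiConcentration (ν.withDensity F) u θ ρ D) {E : Set Ω} (hE : MeasurableSet E)
    (hM : ν.withDensity F univ ≤ ENNReal.ofReal M * ν.withDensity F E) :
    SlotAntiConcentration (ν.withDensity fun x => F x * E.indicator 1 x) u θ ρ (D * M) := by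
  refine slotAntiConcentration_of_dominated hD hρ ?_ h ?_
  · exact Measure.le_iff'.1 (withDensity_mono (ae_of_all _ (mul_indicator_one_le F E))) _
  · rwa [withDensity_mul_indicator_univ ν F hE]

/-- **THE MASS RATIO `2` FROM THE UNION BOUND**, in the binder shape of `slotAntiConcentration_withDensity_drop`:
finitely many dropped tests with pass events `Pass i`, each FAILING with relative mass `≤ q` under the finite law `μ′`,
and `#I·q ≤ 1/2`, give `μ′(everything) ≤ 2·μ′(⋂_i Pass i)`
(`T4ShellMeasureLocal.measure_univ_le_two_mul_of_unionBound`, BY NAME). [folklore] -/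
theorem massRatio_two_of_unionBound (μ' : Measure Ω) [IsFiniteMeasure μ'] {κ : Type*} (I : Finset κ)
    (Pass : κ → Set Ω) {q : ℝ} (hfail : ∀ i ∈ I, μ' (Pass i)ᶜ ≤ ENNReal.ofReal q * μ' univ)
    (hm : (I.card : ℝ) * q ≤ 1 / 2) :
    μ' univ ≤ ENNReal.ofReal 2 * μ' (⋂ i ∈ I, Pass i) := by
  have h := measure_univ_le_two_mul_of_unionBound μ' I (fun i => (Pass i)ᶜ) hfail hm
  simp only [compl_compl] at h
  rwa [show ENNReal.ofReal 2 = (2 : ℝ≥0∞) by norm_num]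

/-- **(M1) WITH FINITELY MANY DROPPED CO-TESTS, MASS RATIO PLACED (`M = 2`).**  `slotAntiConcentration_withDensity_drop`
with `E = ⋂_{i∈I} Pass i` and the union-bound data of `massRatio_two_of_unionBound` for the law `F dν` (finite):
constant `D·2`. [folklore] -/
theorem slotAntiConcentration_withDensity_drop_two {F : Ω → ℝ≥0∞} [IsFiniteMeasure (ν.withDensity F)]
    {u : Ω → ℝ} {θ ρ D : ℝ} (hD : 0 ≤ D) (hρ : 0 ≤ ρ) (h : SlotAntiConcentration (ν.withDensity F) u θ ρ D)
    {κ : Type*} (I : Finset κ) {Pass : κ → Set Ω} (hPass : ∀ i ∈ I, MeasurableSet (Pass i)) {q : ℝ}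
    (hfail : ∀ i ∈ I, ν.withDensity F (Pass i)ᶜ ≤ ENNReal.ofReal q * ν.withDensity F univ)
    (hm : (I.card : ℝ) * q ≤ 1 / 2) :
    SlotAntiConcentration (ν.withDensity fun x => F x * (⋂ i ∈ I, Pass i).indicator 1 x) u θ ρ (D * 2) :=
  slotAntiConcentration_withDensity_drop ν hD hρ h (Finset.measurableSet_biInter I hPass)
    (massRatio_two_of_unionBound (ν.withDensity F) I Pass hfail hm)

/-- **SHELL-NEUTRAL FACTORS ARE FREE (mass ratio `1`).**  If `F′ dν` satisfies (M1) for `u, θ, ρ` with constant `D`,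
`F′ ≤ F` everywhere and `F ≤ F′` ON THE THRESHOLD SHELL `{θ(1−ρ) ≤ u < θ}` (so `F = F′` there), then `F dν` satisfies
(M1) with the SAME constant: the shell masses agree (`setLIntegral_mono`, `ν` s-finite, `F′` measurable) and the
total mass only grows.  Use: re-inserting a co-test that the slot's own classifier implies on the shell (the slot's
own box plaquettes at a threshold `σ ≥ θ`), or removing one. [folklore] -/
theorem slotAntiConcentration_withDensity_of_le_on_shell [SFinite ν] {F F' : Ω → ℝ≥0∞} (hF' : Measurable F')
    {u : Ω → ℝ} {θ ρ D : ℝ} (h : SlotAntiConcentration (ν.withDensity F') u θ ρ D)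
    (hle : ∀ x, F' x ≤ F x) (hshell : ∀ x, θ * (1 - ρ) ≤ u x → u x < θ → F x ≤ F' x) :
    SlotAntiConcentration (ν.withDensity F) u θ ρ D := by
  unfold SlotAntiConcentration at h ⊢
  have hS : ν.withDensity F {x | θ * (1 - ρ) ≤ u x ∧ u x < θ} ≤
      ν.withDensity F' {x | θ * (1 - ρ) ≤ u x ∧ u x < θ} := by
    rw [withDensity_apply' _ _, withDensity_apply' _ _]
    exact setLIntegral_mono hF' fun x hx => hshell x hx.1 hx.2
  have hU : ν.withDensity F' univ ≤ ν.withDensity F univ :=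
    Measure.le_iff'.1 (withDensity_mono (ae_of_all _ hle)) _
  exact hS.trans (h.trans (mul_le_mul' le_rfl hU))

end Abstract

/-! ## §2 Plaquette co-tests: split, monotonicity, cover (any gauge group) -/

section CoTests

variable {P : Params} {j : ℕ} {G : Type*} [GaugeGroup G]

/-- a co-test on a smaller plaquette set is weaker. [folklore] -/
theorem plaqSmallOn_anti {Q Q' : Set (Plaq P j)} (hQ : Q ⊆ Q') {η : ℝ} {U : GaugeField P j G}
    (h : PlaqSmallOn Q' η U) : PlaqSmallOn Q η U := fun p hp => h p (hQ hp)

/-- a co-test at a larger threshold is weaker. [folklore] -/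
theorem plaqSmallOn_mono_threshold {Q : Set (Plaq P j)} {η η' : ℝ} (hη : η ≤ η') {U : GaugeField P j G}
    (h : PlaqSmallOn Q η U) : PlaqSmallOn Q η' U := fun p hp => (h p hp).trans_le hη

/-- a co-test on a union is the conjunction. [folklore] -/
theorem plaqSmallOn_union {Q Q' : Set (Plaq P j)} {η : ℝ} {U : GaugeField P j G} :
    PlaqSmallOn (Q ∪ Q') η U ↔ PlaqSmallOn Q η U ∧ PlaqSmallOn Q' η U :=
  ⟨fun h => ⟨fun p hp => h p (Or.inl hp), fun p hp => h p (Or.inr hp)⟩,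
    fun h p hp => hp.elim (h.1 p) (h.2 p)⟩

/-- **THE SPLIT OF A NEIGHBOUR CUBE'S TEST** relative to a plaquette set `B` (the slot's box): as events,
`{Q η-small} = {Q ∩ B η-small} ∩ {Q \ B η-small}` — kept interior part × dropped straddling/exterior part. [folklore] -/
theorem setOf_plaqSmallOn_split (Q B : Set (Plaq P j)) (η : ℝ) :
    {U : GaugeField P j G | PlaqSmallOn Q η U} =
      {U | PlaqSmallOn (Q ∩ B) η U} ∩ {U | PlaqSmallOn (Q \ B) η U} := by
  ext U
  simp only [mem_setOf_eq, mem_inter_iff]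
  refine ⟨fun h => ⟨fun p hp => h p hp.1, fun p hp => h p hp.1⟩, fun ⟨h1, h2⟩ p hp => ?_⟩
  by_cases hb : p ∈ B
  · exact h1 p ⟨hp, hb⟩
  · exact h2 p ⟨hp, hb⟩

/-- the same split for the tree's characteristic function `chiSmall` (B14 (1.1)):
`χ(Q, η) = χ(Q ∩ B, η) · χ(Q \ B, η)`. [folklore] -/
theorem chiSmall_split (Q B : Set (Plaq P j)) (η : ℝ) (U : GaugeField P j G) :
    chiSmall Q η U = chiSmall (Q ∩ B) η U * chiSmall (Q \ B) η U := by
  have h : PlaqSmallOn Q η U ↔ PlaqSmallOn (Q ∩ B) η U ∧ PlaqSmallOn (Q \ B) η U := by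
    have h' := congrArg (U ∈ ·) (setOf_plaqSmallOn_split (G := G) Q B η)
    simpa only [mem_setOf_eq, mem_inter_iff, eq_iff_iff] using h'
  unfold chiSmall
  by_cases h1 : PlaqSmallOn (Q ∩ B) η U <;> by_cases h2 : PlaqSmallOn (Q \ B) η U <;>
    simp [h, h1, h2]

/-- **THE SPLIT FOR A FINITE FAMILY OF CO-TESTS**: all tests `Q_i`, `i ∈ I`, pass iff the union of their interior
parts passes and every remainder `Q_i \ B` passes. [folklore] -/
theorem biInter_setOf_plaqSmallOn_split {κ : Type*} (I : Finset κ) (Q : κ → Set (Plaq P j))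
    (B : Set (Plaq P j)) (η : ℝ) :
    (⋂ i ∈ I, {U : GaugeField P j G | PlaqSmallOn (Q i) η U}) =
      {U | PlaqSmallOn (⋃ i ∈ I, Q i ∩ B) η U} ∩ ⋂ i ∈ I, {U | PlaqSmallOn (Q i \ B) η U} := by
  ext U
  simp only [mem_iInter, mem_setOf_eq, mem_inter_iff]
  refine ⟨fun h => ⟨fun p hp => ?_, fun i hi p hp => h i hi p hp.1⟩, fun ⟨h1, h2⟩ i hi p hp => ?_⟩
  · simp only [mem_iUnion, mem_inter_iff, exists_prop] at hp
    obtain ⟨i, hi, hpQ, -⟩ := hp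
    exact h i hi p hpQ
  · by_cases hb : p ∈ B
    · exact h1 p (mem_biUnion hi ⟨hp, hb⟩)
    · exact h2 i hi p ⟨hp, hb⟩

/-- **THE COVER LEMMA**: if the box plaquettes `B` are covered by the slot's own classifier plaquettes `P_u` and the
other tests' regions `Q_i`, then `P_u` `σ`-small and every interior part `Q_i ∩ B` `σ`-small give `B` `σ`-small.
[folklore] -/
theorem plaqSmallOn_of_cover {κ : Type*} {I : Finset κ} {Q : κ → Set (Plaq P j)} {B Pu : Set (Plaq P j)}
    (hcov : B ⊆ Pu ∪ ⋃ i ∈ I, Q i) {σ : ℝ} {U : GaugeField P j G} (hu : PlaqSmallOn Pu σ U)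
    (hQ : ∀ i ∈ I, PlaqSmallOn (Q i ∩ B) σ U) : PlaqSmallOn B σ U := by
  intro p hp
  rcases hcov hp with h | h
  · exact hu p h
  · simp only [mem_iUnion, exists_prop] at h
    obtain ⟨i, hi, hpQ⟩ := h
    exact hQ i hi p ⟨hpQ, hp⟩

/-- the family co-test event is measurable (`RegularGaugeGroup`). [folklore] -/
theorem measurableSet_biInter_plaqSmallOn [MeasurableSpace G] [RegularGaugeGroup G] {κ : Type*} (I : Finset κ)
    (Q : κ → Set (Plaq P j)) (η : ℝ) :
    MeasurableSet (⋂ i ∈ I, {U : GaugeField P j G | PlaqSmallOn (Q i) η U}) :=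
  Finset.measurableSet_biInter I fun i _ => measurableSet_plaqSmallOn (Q i) η

end CoTests

/-! ## §3 The realized level-0 slot measure with co-tests (`G = SU(2)`) -/

section Realized

variable {P : Params} {j : ℕ}

/-- **THE LEVEL-0 CLASSIFIER IS THE SLOT'S OWN TEST**: `max_{p ∈ P_u} dist1 U(∂p) < θ ↔ P_u θ-small`. [folklore] -/
theorem wilsonU_lt_iff {Pu : Finset (Plaq P j)} (hPu : Pu.Nonempty) {θ : ℝ} {U : GaugeField P j SU2} :
    wilsonU hPu U < θ ↔ PlaqSmallOn (↑Pu : Set (Plaq P j)) θ U := by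
  unfold wilsonU PlaqSmallOn
  rw [Finset.sup'_lt_iff]
  simp only [Finset.mem_coe]

/-- **(M1)₀ WITH CO-TESTS FROM THE BOX-WINDOWED LAW (the (MR)₀ wiring).**  Data on `T^{(j)}` of the cell, `G = SU(2)`:
a box `[lo, hi]` with co-test threshold `σ`; ANY measurable weight `W ≥ 0`; the slot's classifier plaquettes
`P_u ≠ ∅` and threshold `θ ≤ σ`; finitely many OTHER co-tests `1[Q_i σ-small]`, `i ∈ I` (any plaquette sets), and
any further measurable dropped event `E`.  HYPOTHESES: (M1)₀ for the BOX-WINDOWED law `(1[box σ-small]·W) dU` with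
constant `D` (row S1's shape); the COVER `boxPlaqs ⊆ P_u ∪ ⋃_i Q_i` (every box plaquette outside the slot's own
region is tested by somebody); THE DISPLAYED MASS-RATIO BINDER `hM`: under the box-windowed law the dropped event
«every remainder `Q_i \ box` σ-small, and `E`» has mass ratio `M`.  CONCLUSION: (M1)₀ for the CO-TESTED law
`(1[⋂_i Q_i σ-small ∩ E]·W) dU` — the box window is GONE from the density — with constant `D·M`.  Proof: drop the
remainders and `E` (§1 `…_drop`), then trade the box window for the interior parts of the co-tests, which is free on
the shell `{u < θ ≤ σ}` by the cover (§1 `…_of_le_on_shell`, §2). [folklore] -/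
theorem slotAntiConcentration_coTests_of_boxTest {lo hi : Fin P.d → ℤ} {σ θ ρ D M : ℝ}
    {W : GaugeField P j SU2 → ℝ≥0∞} (hW : Measurable W) {Pu : Finset (Plaq P j)} (hPu : Pu.Nonempty)
    (h : SlotAntiConcentration
      ((fieldMeasure P j SU2).withDensity fun U => (boxTest lo hi σ).indicator 1 U * W U) (wilsonU hPu) θ ρ D)
    (hD : 0 ≤ D) (hρ : 0 ≤ ρ) (hθσ : θ ≤ σ)
    {κ : Type*} (I : Finset κ) (Q : κ → Set (Plaq P j))
    (hcov : boxPlaqs lo hi ⊆ (↑Pu : Set (Plaq P j)) ∪ ⋃ i ∈ I, Q i)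
    {E : Set (GaugeField P j SU2)} (hE : MeasurableSet E)
    (hM : (fieldMeasure P j SU2).withDensity (fun U => (boxTest lo hi σ).indicator 1 U * W U) univ ≤
      ENNReal.ofReal M * (fieldMeasure P j SU2).withDensity (fun U => (boxTest lo hi σ).indicator 1 U * W U)
        ((⋂ i ∈ I, {U | PlaqSmallOn (Q i \ boxPlaqs lo hi) σ U}) ∩ E)) :
    SlotAntiConcentration
      ((fieldMeasure P j SU2).withDensity fun U =>
        ((⋂ i ∈ I, {U | PlaqSmallOn (Q i) σ U}) ∩ E).indicator 1 U * W U) (wilsonU hPu) θ ρ (D * M) := by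
  -- the dropped event
  set Dr : Set (GaugeField P j SU2) := (⋂ i ∈ I, {U | PlaqSmallOn (Q i \ boxPlaqs lo hi) σ U}) ∩ E with hDr
  have hDrm : MeasurableSet Dr := (measurableSet_biInter_plaqSmallOn I _ σ).inter hE
  -- step 1: drop it
  have h1 := slotAntiConcentration_withDensity_drop (fieldMeasure P j SU2) hD hρ h hDrm hM
  -- step 2: trade the box window for the interior parts of the co-tests (free on the shell)
  have hmeas : Measurable fun U : GaugeField P j SU2 =>
      ((boxTest lo hi σ).indicator 1 U * W U) * Dr.indicator 1 U :=
    (((measurable_one.indicator (measurableSet_boxTest lo hi σ)).mul hW)).mul (measurable_one.indicator hDrm)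
  refine slotAntiConcentration_withDensity_of_le_on_shell (fieldMeasure P j SU2) hmeas h1
    (fun U => ?_) (fun U _ hu => ?_)
  · -- pointwise: `1[box]·W·1[Dr] ≤ 1[⋂ Q_i ∩ E]·W`
    by_cases hb : U ∈ boxTest lo hi σ
    · by_cases hd : U ∈ Dr
      · have hall : U ∈ (⋂ i ∈ I, {U : GaugeField P j SU2 | PlaqSmallOn (Q i) σ U}) ∩ E := by
          refine ⟨?_, hd.2⟩
          rw [biInter_setOf_plaqSmallOn_split I Q (boxPlaqs lo hi) σ]
          refine ⟨plaqSmallOn_anti (fun p hp => ?_) hb, hd.1⟩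
          simp only [mem_iUnion, mem_inter_iff, exists_prop] at hp
          obtain ⟨_, _, _, hpb⟩ := hp
          exact hpb
        rw [indicator_of_mem hb, indicator_of_mem hd, indicator_of_mem hall]
        simp only [Pi.one_apply, one_mul, mul_one, le_refl]
      · rw [indicator_of_notMem hd, mul_zero]
        exact bot_le
    · rw [indicator_of_notMem hb, zero_mul, zero_mul]
      exact bot_le
  · -- on the shell `u < θ ≤ σ`: `1[⋂ Q_i ∩ E]·W ≤ 1[box]·W·1[Dr]`
    by_cases hall : U ∈ (⋂ i ∈ I, {U : GaugeField P j SU2 | PlaqSmallOn (Q i) σ U}) ∩ E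
    · have hQ : ∀ i ∈ I, PlaqSmallOn (Q i) σ U := by
        have h' := hall.1
        simp only [mem_iInter, mem_setOf_eq] at h'
        exact h'
      have hd : U ∈ Dr := ⟨by
        simp only [mem_iInter, mem_setOf_eq]
        exact fun i hi => plaqSmallOn_anti (fun p hp => hp.1) (hQ i hi), hall.2⟩
      have hPu : PlaqSmallOn (↑Pu : Set (Plaq P j)) σ U :=
        plaqSmallOn_mono_threshold hθσ ((wilsonU_lt_iff hPu).1 hu)
      have hb : U ∈ boxTest lo hi σ :=
        plaqSmallOn_of_cover hcov hPu fun i hi => plaqSmallOn_anti inter_subset_left (hQ i hi)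
      rw [indicator_of_mem hb, indicator_of_mem hd, indicator_of_mem hall]
      simp only [Pi.one_apply, one_mul, mul_one, le_refl]
    · rw [indicator_of_notMem hall, zero_mul]
      exact bot_le

variable [DecidableEq (PBond P j)]

/-- **(M1)₀ FOR `G = SU(2)` WITH THE OTHER CUBES' CO-TESTS — ROW S1 ∘ (MR)₀.**  Row S1's gauge-invariant realized
theorem (`ShellMeasureWilsonGaugeInvariant.slotAntiConcentration_wilson_su2_gaugeInvariant`: non-wrapping box, chart
bonds `Λ` = box bonds off the axial comb, window `0 < S ≤ 1/8`, reach `(d−1)·m·σ ≤ 2S/π`, (SM)₀, `β ≥ 0`, `θ > 0`,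
`0 ≤ δ < 1`, `0 ≤ ρ ≤ (1−δ)/2`) with the slot threshold `θ ≤ σ` (at level 0 all cubes test at `ε₀`: `θ = σ`), the
cover and the DISPLAYED MASS-RATIO BINDER `hM` for the dropped event under the `giF`-law ⟹ (M1)₀ for the law
`1[⋂_i Q_i σ-small ∩ E] · exp(−β Σ_{p∈P_w}(1 − reTr U(∂p))) dU` and the verbatim classifier `max_{p∈P_u} dist1 U(∂p)`,
constant `2(n + β·#P_w·8S(8+32S))/(1−δ) · M`.  `M` is NOT proved (the (MR)₀ estimate); nothing PRINTED is asserted.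
[folklore] -/
theorem slotAntiConcentration_wilson_su2_coTests
    {lo hi : Fin P.d → ℤ} {m : ℕ} (hN : ∀ κ, hi κ - lo κ < P.sitesPerDir j) (hm : ∀ κ, hi κ ≤ lo κ + m)
    (Λ : Finset (PBond P j)) (hΛbox : ∀ b ∈ Λ, b ∈ boxBonds lo hi)
    (hΛcomb : Disjoint Λ (combBonds lo hi))
    (hcov : ∀ b ∈ boxBonds lo hi, b ∉ Λ → b ∈ (combBonds lo hi : Finset (PBond P j)))
    {n : ℕ} (e : ↥Λ × Fin 3 ≃ Fin n)
    {S σ : ℝ} (hS : 0 < S) (hS8 : S ≤ 1 / 8) (hSπ : 3 * S ^ 2 < Real.pi ^ 2) (hσ : 0 < σ)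
    (hrad : ((P.d - 1 : ℕ) : ℝ) * m * σ ≤ 2 * S / Real.pi)
    {Pu : Finset (Plaq P j)} (hPu : Pu.Nonempty) (hPubox : ∀ p ∈ Pu, p ∈ boxPlaqs lo hi)
    (Pw : Finset (Plaq P j)) {β θ δ ρ : ℝ} (hβ : 0 ≤ β) (hθ : 0 < θ) (hθσ : θ ≤ σ) (hδ0 : 0 ≤ δ) (hδ1 : δ < 1)
    (hρ0 : 0 ≤ ρ) (hρ : ρ ≤ (1 - δ) / 2) (hSM : 4 * (8 * S) ^ 2 * Real.exp (2 * (8 * S)) ≤ δ * θ)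
    {κ : Type*} (I : Finset κ) (Q : κ → Set (Plaq P j))
    (hcovQ : boxPlaqs lo hi ⊆ (↑Pu : Set (Plaq P j)) ∪ ⋃ i ∈ I, Q i)
    {E : Set (GaugeField P j SU2)} (hE : MeasurableSet E) {M : ℝ}
    (hM : (fieldMeasure P j SU2).withDensity (giF lo hi σ β Pw) univ ≤
      ENNReal.ofReal M * (fieldMeasure P j SU2).withDensity (giF lo hi σ β Pw)
        ((⋂ i ∈ I, {U | PlaqSmallOn (Q i \ boxPlaqs lo hi) σ U}) ∩ E)) :
    SlotAntiConcentration
      ((fieldMeasure P j SU2).withDensity fun U =>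
        ((⋂ i ∈ I, {U | PlaqSmallOn (Q i) σ U}) ∩ E).indicator 1 U *
          ENNReal.ofReal (Real.exp (-(β * ∑ p ∈ Pw, (1 - reTr (GaugeField.plaqHol U p))))))
      (wilsonU hPu) θ ρ (2 * ((n : ℝ) + β * ∑ _p ∈ Pw, (8 * S) * (8 + 4 * (8 * S))) / (1 - δ) * M) := by
  have hSMσ : 4 * (8 * S) ^ 2 * Real.exp (2 * (8 * S)) ≤ δ * σ :=
    hSM.trans (mul_le_mul_of_nonneg_left hθσ hδ0)
  have h0 := slotAntiConcentration_wilson_su2_gaugeInvariant hN hm Λ hΛbox hΛcomb hcov e hS hS8 hSπ hσ hrad hPu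
    hPubox Pw hβ hθ hδ0 hδ1 hρ0 hρ hSM hSMσ
  have hD : 0 ≤ 2 * ((n : ℝ) + β * ∑ _p ∈ Pw, (8 * S) * (8 + 4 * (8 * S))) / (1 - δ) := by
    have h1δ : 0 < 1 - δ := by linarith
    have hBf : 0 ≤ β * ∑ _p ∈ Pw, (8 * S) * (8 + 4 * (8 * S)) :=
      mul_nonneg hβ (Finset.sum_nonneg fun p _ => by positivity)
    positivity
  have hW : Measurable fun U : GaugeField P j SU2 =>
      ENNReal.ofReal (Real.exp (-(β * ∑ p ∈ Pw, (1 - reTr (GaugeField.plaqHol U p))))) :=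
    ENNReal.measurable_ofReal.comp (Real.measurable_exp.comp ((measurable_const.mul (measurable_wilsonSum Pw))).neg)
  exact slotAntiConcentration_coTests_of_boxTest hW hPu h0 hD hρ0 hθσ I Q hcovQ hE hM

/-- **THE SAME WITH THE MASS RATIO PLACED (`M = 2`) BY THE UNION BOUND.**  No extra dropped event; each of the `#I`
straddling remainders `Q_i \ box` FAILS under the `giF`-law with relative mass `≤ q` (the small-field dominance READING,
B16 (1.89) KIND — a displayed binder, NOT proved) and `#I·q ≤ 1/2` ⟹ constant `2(n + β·#P_w·8S(8+32S))/(1−δ) · 2`.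
[folklore] -/
theorem slotAntiConcentration_wilson_su2_coTests_two
    {lo hi : Fin P.d → ℤ} {m : ℕ} (hN : ∀ κ, hi κ - lo κ < P.sitesPerDir j) (hm : ∀ κ, hi κ ≤ lo κ + m)
    (Λ : Finset (PBond P j)) (hΛbox : ∀ b ∈ Λ, b ∈ boxBonds lo hi)
    (hΛcomb : Disjoint Λ (combBonds lo hi))
    (hcov : ∀ b ∈ boxBonds lo hi, b ∉ Λ → b ∈ (combBonds lo hi : Finset (PBond P j)))
    {n : ℕ} (e : ↥Λ × Fin 3 ≃ Fin n)
    {S σ : ℝ} (hS : 0 < S) (hS8 : S ≤ 1 / 8) (hSπ : 3 * S ^ 2 < Real.pi ^ 2) (hσ : 0 < σ)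
    (hrad : ((P.d - 1 : ℕ) : ℝ) * m * σ ≤ 2 * S / Real.pi)
    {Pu : Finset (Plaq P j)} (hPu : Pu.Nonempty) (hPubox : ∀ p ∈ Pu, p ∈ boxPlaqs lo hi)
    (Pw : Finset (Plaq P j)) {β θ δ ρ : ℝ} (hβ : 0 ≤ β) (hθ : 0 < θ) (hθσ : θ ≤ σ) (hδ0 : 0 ≤ δ) (hδ1 : δ < 1)
    (hρ0 : 0 ≤ ρ) (hρ : ρ ≤ (1 - δ) / 2) (hSM : 4 * (8 * S) ^ 2 * Real.exp (2 * (8 * S)) ≤ δ * θ)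
    {κ : Type*} (I : Finset κ) (Q : κ → Set (Plaq P j))
    (hcovQ : boxPlaqs lo hi ⊆ (↑Pu : Set (Plaq P j)) ∪ ⋃ i ∈ I, Q i) {q : ℝ}
    (hfail : ∀ i ∈ I, (fieldMeasure P j SU2).withDensity (giF lo hi σ β Pw)
        {U | PlaqSmallOn (Q i \ boxPlaqs lo hi) σ U}ᶜ ≤
      ENNReal.ofReal q * (fieldMeasure P j SU2).withDensity (giF lo hi σ β Pw) univ)
    (hmq : (I.card : ℝ) * q ≤ 1 / 2) :
    SlotAntiConcentration
      ((fieldMeasure P j SU2).withDensity fun U =>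
        (⋂ i ∈ I, {U | PlaqSmallOn (Q i) σ U}).indicator 1 U *
          ENNReal.ofReal (Real.exp (-(β * ∑ p ∈ Pw, (1 - reTr (GaugeField.plaqHol U p))))))
      (wilsonU hPu) θ ρ (2 * ((n : ℝ) + β * ∑ _p ∈ Pw, (8 * S) * (8 + 4 * (8 * S))) / (1 - δ) * 2) := by
  haveI : IsFiniteMeasure ((fieldMeasure P j SU2).withDensity (giF lo hi σ β Pw)) :=
    isFiniteMeasure_withDensity
      ((lintegral_mono fun U => giF_le_one lo hi hβ Pw U).trans_lt (by simp)).ne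
  have hM := massRatio_two_of_unionBound ((fieldMeasure P j SU2).withDensity (giF lo hi σ β Pw)) I
    (fun i => {U | PlaqSmallOn (Q i \ boxPlaqs lo hi) σ U}) hfail hmq
  have h := slotAntiConcentration_wilson_su2_coTests hN hm Λ hΛbox hΛcomb hcov e hS hS8 hSπ hσ hrad hPu hPubox Pw
    hβ hθ hθσ hδ0 hδ1 hρ0 hρ hSM I Q hcovQ MeasurableSet.univ (M := 2) (by rwa [inter_univ])
  simpa only [inter_univ] using h

end Realized

end Summit.QuantumFields.BalabanUV.T4Continuum.ShellMeasureWilsonStraddle
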